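import Summits.CriticalPhenomena.Ising3DConformalLimit.Theorems.ReflectionTwinExistsContinuousLimitSubsequentialInversionTransfer
import Summits.CriticalPhenomena.Ising3DConformalLimit.Theorems.ReflectionTwinExistsContinuousLimitInversionBegetsDilation
import Summits.CriticalPhenomena.Ising3DConformalLimit.Theorems.ReflectionTwinExistsContinuousLimitReduction
import Summits.CriticalPhenomena.Ising3DConformalLimit.Theorems.ExistsScaleCovariantLimit.Negative.PinnedForm
import Summits.CriticalPhenomena.Ising3DConformalLimit.Theorems.MoebiusLimitExists.Negative.CompactnessContent
import Summits.CriticalPhenomena.Ising3DConformalLimit.Theorems.MoebiusLimitExists.Negative.PinnedClusterPoints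
import Summits.CriticalPhenomena.Ising3DConformalLimit.Theorems.HyperoctahedralRPExistsScaleCovariantLimitDyadicLimitContinuous
import Summits.CriticalPhenomena.Ising3DConformalLimit.Theorems.EnergyNotSigmaSquaredMoebiusLimitExistsDefs
import Summits.CriticalPhenomena.Ising3DConformalLimit.Theorems.PrecisionLaplacianMoebiusLimitOfTwoPointLawInversionBegetsRotations
import HarnessLib

/-!
# `clusterProxyUniversality_iff_inversionCovariant` (K1 ⟺ K1′) — crux `ReflectionTwin.ExistsContinuousLimit`
# (stmt-CriticalPhenomena-4582), line `Sketch`, registered sub-goal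

For a normalised, non-degenerate cluster point `S` of the pinned `ℤ³` zoom, the ideator's K1 "cluster proxy
universality" (`S` is the locally renormalised limit, along the meshes `u_k`, of lattice families `P k` that
are EXACTLY invariant under the unit inversion `ι v = v/‖v‖²` off the origin, the pinned weight ratios
`ρ_pin(u_k‖p‖)/ρ_pin(u_k/‖p‖)` converging to a continuous positive `w`) is EQUIVALENT to K1′ (covariance of
`S` under `ι` with SOME continuous positive weight).

* (⟹) is the landed K3 `stub_subsequentialInversionTransfer` (p154862).
* (⟸) The weight-ratio limit is forced by the lattice: `ρ_pin(δr)/ρ_pin(δ/r)` is EXACTLY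
  `√(F_δ(r)/F_δ(1/r))`, `F_δ(t)` the pinned two-point zoom at the axis pair `(0, t e₀)`
  (`proxy_ratio_eq_sqrt`), so along the cluster sequence it converges locally uniformly off the origin to
  `W(v) = √(S₂(0,‖v‖e₀)/S₂(0,e₀/‖v‖))` (`proxy_ratio_tendstoLocallyUniformlyOn`) — whence, by K3's
  transfer lemma, ANY proxy family witnessing K1 forces `S n x = (∏ W(xᵢ)) S n (ι x)`: K1 ⟸ K1′ needs
  `W · w′ ≡ 1`, i.e. scale covariance. The landed K2 (`stub_inversionBegetsDilation`, p155681) turns K1′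
  (plus translation invariance and continuity, automatic for cluster points) into scale and inversion
  covariance with one exponent `Δ`;
  then `S₂(0, t e₀) = t^{-2Δ}` (`S₂(0,e₀) = 1` by pinning), `W = ‖·‖^{-2Δ}` (`proxy_W_eq`), and the
  ι-SYMMETRISED renormalised cluster point
  `P k n p := (S n p / ∏ ρ_pin(u_k‖pᵢ‖) + S n (ι p) / ∏ ρ_pin(u_k‖ι pᵢ‖)) / 2`
  is exactly ι-symmetric (`ι² = id`) and `(∏ ρ_pin(u_k‖pᵢ‖)) P k n p = (S n p + S n (ι p) ∏ᵢ f_k(pᵢ)) / 2 →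
  (S n p + (∏ ‖pᵢ‖^{2Δ} S n p)(∏ ‖pᵢ‖^{-2Δ})) / 2 = S n p` locally uniformly off the diagonals and the origin
  (`proxy_renormalised_tendsto`; locally uniform convergence to a continuous limit is continuous convergence,
  `proxy_tendstoLocallyUniformlyOn_iff`).
So the abstract proxies of K1 carry no lattice content beyond K1′. [folklore]
-/

noncomputable section

namespace Summit.CriticalPhenomena.Ising3DConformalLimit.ReflectionTwinExistsContinuousLimit

open Filter Topology Set Function Uniformity
open Literature.Probability.LatticeModels EuclideanGeometry
open Summit.CriticalPhenomena.Ising3DConformalLimit.MoebiusLimitExistsOnlyInteraction (rhoPin IsClusterPoint)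
open Summit.CriticalPhenomena.Ising3DConformalLimit.PrecisionLaplacianMoebiusLimitOfTwoPointLaw
  (norm_inversion_zero_one)
open Summit.CriticalPhenomena.Ising3DConformalLimit.PinnedClusterPoints (criticalTwoPoint_pos3 clusterPoint_cfg01)
open Summit.CriticalPhenomena.Ising3DConformalLimit.MoebiusLimitExistsNegative (rescaledCorrelator_axisPair)
open Summit.CriticalPhenomena.Ising3DConformalLimit.ExistsScaleCovariantLimitNegative (rhoPin_pos)
open Summit.CriticalPhenomena.Ising3DConformalLimit.Cruxes.ExistsScaleCovariantLimit.TwoHierarchies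
  (continuousOn_seqLimit)

/-! ### Locally uniform convergence to a continuous limit is continuous convergence -/

/-- Locally uniform convergence on `s` to a limit CONTINUOUS on `s` is continuous convergence: at every
`x ∈ s`, `F i y → f x` as `i → p` and `y → x` within `s`, jointly. [folklore] -/
theorem proxy_tendstoLocallyUniformlyOn_iff {X ι β : Type*} [TopologicalSpace X] [UniformSpace β]
    {F : ι → X → β} {f : X → β} {p : Filter ι} {s : Set X} (hf : ContinuousOn f s) :
    TendstoLocallyUniformlyOn F f p s ↔
      ∀ x ∈ s, Tendsto (fun y : ι × X => F y.1 y.2) (p ×ˢ 𝓝[s] x) (𝓝 (f x)) := by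
  rw [tendstoLocallyUniformlyOn_iff_forall_tendsto]
  refine forall₂_congr fun x hx => ?_
  have h2 : Tendsto (fun y : ι × X => (f x, f y.2)) (p ×ˢ 𝓝[s] x) (𝓤 β) :=
    Uniform.tendsto_nhds_right.1 ((hf x hx).tendsto.comp tendsto_snd)
  rw [Uniform.tendsto_nhds_right]
  exact ⟨fun h1 => h2.uniformity_trans h1, fun h1 => h2.uniformity_symm.uniformity_trans h1⟩

/-! ### The pinned weight ratio is a lattice two-point ratio -/

/-- `t e₀ = (t, 0, 0)`. [folklore] -/
theorem proxy_smul_unitVec (t : ℝ) :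
    t • EuclideanSpace.single (0 : Fin 3) (1 : ℝ) = EuclideanSpace.single (0 : Fin 3) t := by
  ext j
  by_cases hj : j = 0
  · subst hj; simp
  · simp [hj]

/-- The axis pair `(0, t e₀)` is the `t`-dilate of `(0, e₀)`. [folklore] -/
theorem proxy_axisPair_eq_smul (t : ℝ) :
    (![0, EuclideanSpace.single (0 : Fin 3) t] : Fin 2 → EuclideanSpace ℝ (Fin 3)) =
      fun i => t • (![0, EuclideanSpace.single (0 : Fin 3) (1 : ℝ)] : Fin 2 → EuclideanSpace ℝ (Fin 3)) i := by
  funext i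
  fin_cases i
  · simp
  · simp [proxy_smul_unitVec]

/-- `t ↦ (0, t e₀)` is continuous. [folklore] -/
theorem proxy_continuous_axisPair :
    Continuous fun t : ℝ => (![0, EuclideanSpace.single (0 : Fin 3) t] : Fin 2 → EuclideanSpace ℝ (Fin 3)) := by
  simpa only [proxy_smul_unitVec] using
    (continuous_const.matrixVecCons ((continuous_id.smul continuous_const).matrixVecCons continuous_const) :
      Continuous fun t : ℝ =>
        (![0, t • EuclideanSpace.single (0 : Fin 3) (1 : ℝ)] : Fin 2 → EuclideanSpace ℝ (Fin 3)))

/-- **The pinned weight ratio is EXACTLY a ratio of the pinned two-point zoom at two axis pairs**: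
`ρ_pin(δ r)/ρ_pin(δ/r) = √(F_δ(r)/F_δ(r⁻¹))`, `F_δ(t) = ρ_pin(δ)² ⟨σ₀ σ_{⌊t/δ⌋e₀}⟩_{β_c}` (the floors
match: `1/(δr) = r⁻¹/δ`, `1/(δ/r) = r/δ`). [folklore] -/
theorem proxy_ratio_eq_sqrt (δ r : ℝ) :
    rhoPin (δ * r) / rhoPin (δ / r) =
      Real.sqrt (rescaledCorrelator (criticalCorr 3) rhoPin 2 δ ![0, EuclideanSpace.single 0 r] /
        rescaledCorrelator (criticalCorr 3) rhoPin 2 δ ![0, EuclideanSpace.single 0 r⁻¹]) := by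
  rw [rescaledCorrelator_axisPair, rescaledCorrelator_axisPair,
    mul_div_mul_left _ _ (pow_pos (rhoPin_pos δ) 2).ne']
  have ha : 0 < criticalTwoPoint 3 (Pi.single (0 : Fin 3) ⌊r / δ⌋) := criticalTwoPoint_pos3 _
  have hb : 0 < criticalTwoPoint 3 (Pi.single (0 : Fin 3) ⌊r⁻¹ / δ⌋) := criticalTwoPoint_pos3 _
  have e1 : (1 : ℝ) / (δ * r) = r⁻¹ / δ := by rw [one_div, mul_inv_rev, div_eq_mul_inv]
  have e2 : (1 : ℝ) / (δ / r) = r / δ := one_div_div δ r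
  simp only [MoebiusLimitExistsOnlyInteraction.rhoPin, e1, e2]
  rw [Real.sqrt_eq_rpow, ← Real.div_rpow hb.le ha.le, Real.rpow_neg (div_nonneg hb.le ha.le),
    ← Real.inv_rpow (div_nonneg hb.le ha.le), inv_div]

/-- **The weight-ratio limit is forced by the lattice.** Along a mesh sequence `u_k → 0⁺` on which the
pinned two-point zoom converges locally uniformly off the diagonal to a non-degenerate `S₂`, the pinned
weight ratios `ρ_pin(u_k‖p‖)/ρ_pin(u_k/‖p‖)` converge locally uniformly off the origin to
`W(p) = √(S₂(0, ‖p‖e₀)/S₂(0, e₀/‖p‖))`. [folklore] -/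
theorem proxy_ratio_tendstoLocallyUniformlyOn {S : CorrFamily 3} {u : ℕ → ℝ}
    (hu : Tendsto u atTop (𝓝[>] (0 : ℝ)))
    (h2 : TendstoLocallyUniformlyOn (fun k => rescaledCorrelator (criticalCorr 3) rhoPin 2 (u k)) (S 2)
      atTop (NonCoincident 3 2))
    (hnd : IsNondegenerateTwoPoint S) :
    TendstoLocallyUniformlyOn
      (fun (k : ℕ) (p : EuclideanSpace ℝ (Fin 3)) => rhoPin (u k * ‖p‖) / rhoPin (u k / ‖p‖))
      (fun p => Real.sqrt (S 2 ![0, EuclideanSpace.single 0 ‖p‖] / S 2 ![0, EuclideanSpace.single 0 ‖p‖⁻¹]))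
      atTop {0}ᶜ := by
  have hSc : ContinuousOn (S 2) (NonCoincident 3 2) := continuousOn_seqLimit hu h2
  -- the two axis maps `p ↦ (0, ‖p‖e₀)`, `p ↦ (0, e₀/‖p‖)`
  have hA : Continuous fun p : EuclideanSpace ℝ (Fin 3) =>
      (![0, EuclideanSpace.single 0 ‖p‖] : Fin 2 → EuclideanSpace ℝ (Fin 3)) :=
    proxy_continuous_axisPair.comp continuous_norm
  have hA' : ContinuousOn (fun p : EuclideanSpace ℝ (Fin 3) =>
      (![0, EuclideanSpace.single 0 ‖p‖⁻¹] : Fin 2 → EuclideanSpace ℝ (Fin 3))) {0}ᶜ :=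
    proxy_continuous_axisPair.comp_continuousOn
      (continuous_norm.continuousOn.inv₀ fun p hp => norm_ne_zero_iff.2 hp)
  have hmA : MapsTo (fun p : EuclideanSpace ℝ (Fin 3) =>
      (![0, EuclideanSpace.single 0 ‖p‖] : Fin 2 → EuclideanSpace ℝ (Fin 3))) {0}ᶜ (NonCoincident 3 2) :=
    fun p hp => zero_unitVec_mem_nonCoincident (norm_ne_zero_iff.2 hp)
  have hmA' : MapsTo (fun p : EuclideanSpace ℝ (Fin 3) =>
      (![0, EuclideanSpace.single 0 ‖p‖⁻¹] : Fin 2 → EuclideanSpace ℝ (Fin 3))) {0}ᶜ (NonCoincident 3 2) :=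
    fun p hp => zero_unitVec_mem_nonCoincident (inv_ne_zero (norm_ne_zero_iff.2 hp))
  have hWc : ContinuousOn (fun p : EuclideanSpace ℝ (Fin 3) =>
      Real.sqrt (S 2 ![0, EuclideanSpace.single 0 ‖p‖] / S 2 ![0, EuclideanSpace.single 0 ‖p‖⁻¹])) {0}ᶜ :=
    ((hSc.comp hA.continuousOn hmA).div (hSc.comp hA' hmA') fun p hp => (hnd _ (hmA' hp)).ne').sqrt
  rw [proxy_tendstoLocallyUniformlyOn_iff hWc]
  rw [proxy_tendstoLocallyUniformlyOn_iff hSc] at h2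
  intro x hx
  have tA : Tendsto (fun y : ℕ × EuclideanSpace ℝ (Fin 3) =>
      (y.1, (![0, EuclideanSpace.single 0 ‖y.2‖] : Fin 2 → EuclideanSpace ℝ (Fin 3))))
      (atTop ×ˢ 𝓝[{0}ᶜ] x) (atTop ×ˢ 𝓝[NonCoincident 3 2] ![0, EuclideanSpace.single 0 ‖x‖]) :=
    tendsto_fst.prodMk ((hA.continuousWithinAt.tendsto_nhdsWithin hmA).comp tendsto_snd)
  have tA' : Tendsto (fun y : ℕ × EuclideanSpace ℝ (Fin 3) =>
      (y.1, (![0, EuclideanSpace.single 0 ‖y.2‖⁻¹] : Fin 2 → EuclideanSpace ℝ (Fin 3))))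
      (atTop ×ˢ 𝓝[{0}ᶜ] x) (atTop ×ˢ 𝓝[NonCoincident 3 2] ![0, EuclideanSpace.single 0 ‖x‖⁻¹]) :=
    tendsto_fst.prodMk (((hA' x hx).tendsto_nhdsWithin hmA').comp tendsto_snd)
  have T := (((h2 _ (hmA hx)).comp tA).div ((h2 _ (hmA' hx)).comp tA') (hnd _ (hmA' hx)).ne').sqrt
  refine T.congr fun y => ?_
  simp only [Function.comp_def, Pi.div_apply]
  exact (proxy_ratio_eq_sqrt (u y.1) ‖y.2‖).symm

/-! ### Under scale covariance the forced weight is `‖·‖^{-2Δ}` -/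

/-- `S₂(0, t e₀) = t^{-2Δ}` for a scale-covariant `S` pinned at `S₂(0, e₀) = 1`. [folklore] -/
theorem proxy_axisPair_apply {S : CorrFamily 3} {Δ : ℝ} (hsc : IsScaleCovariant Δ S)
    (h01 : S 2 ![0, EuclideanSpace.single 0 1] = 1) {t : ℝ} (ht : 0 < t) :
    S 2 ![0, EuclideanSpace.single 0 t] = t ^ (-(2 * Δ)) := by
  have h := hsc 2 t ht ![0, EuclideanSpace.single 0 1]
  rw [← proxy_axisPair_eq_smul, h01, mul_one] at h
  rw [h]
  congr 1
  push_cast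
  ring

/-- The forced weight of a scale-covariant pinned `S` is `W(v) = ‖v‖^{-2Δ}`. [folklore] -/
theorem proxy_W_eq {S : CorrFamily 3} {Δ : ℝ} (hsc : IsScaleCovariant Δ S)
    (h01 : S 2 ![0, EuclideanSpace.single 0 1] = 1) {v : EuclideanSpace ℝ (Fin 3)} (hv : v ≠ 0) :
    Real.sqrt (S 2 ![0, EuclideanSpace.single 0 ‖v‖] / S 2 ![0, EuclideanSpace.single 0 ‖v‖⁻¹]) =
      (‖v‖ ^ (2 * Δ))⁻¹ := by
  have hr : 0 < ‖v‖ := norm_pos_iff.2 hv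
  rw [proxy_axisPair_apply hsc h01 hr, proxy_axisPair_apply hsc h01 (inv_pos.2 hr),
    Real.inv_rpow hr.le, div_inv_eq_mul, Real.sqrt_mul_self (Real.rpow_nonneg hr.le _),
    Real.rpow_neg hr.le]

/-! ### The symmetrised renormalised cluster point converges back to `S` -/

/-- **Convergence of the ι-symmetrised proxies.** If `S n` is continuous off the diagonals and covariant
under the unit inversion with a continuous weight `w'` off the origin, and the pinned weight ratios converge
locally uniformly off the origin to a continuous `w` with `w' w = 1`, then the renormalised symmetrised family
`(∏ ρ_pin(u_k‖pᵢ‖)) · (S n p / ∏ ρ_pin(u_k‖pᵢ‖) + S n (ι p) / ∏ ρ_pin(u_k‖ι pᵢ‖)) / 2` converges to `S n`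
locally uniformly on the non-coincident configurations off the origin. [folklore] -/
theorem proxy_renormalised_tendsto {S : CorrFamily 3} {u : ℕ → ℝ}
    {w w' : EuclideanSpace ℝ (Fin 3) → ℝ} {n : ℕ}
    (hS : ContinuousOn (S n) (NonCoincident 3 n))
    (hcov : ∀ x : Fin n → EuclideanSpace ℝ (Fin 3), (∀ i, x i ≠ 0) →
      S n (fun i => inversion (0 : EuclideanSpace ℝ (Fin 3)) 1 (x i)) = (∏ i, w' (x i)) * S n x)
    (hw'c : ContinuousOn w' {0}ᶜ) (hwc : ContinuousOn w {0}ᶜ)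
    (hww' : ∀ v, v ≠ 0 → w' v * w v = 1)
    (hratio : TendstoLocallyUniformlyOn
      (fun (k : ℕ) (p : EuclideanSpace ℝ (Fin 3)) => rhoPin (u k * ‖p‖) / rhoPin (u k / ‖p‖))
      w atTop {0}ᶜ) :
    TendstoLocallyUniformlyOn
      (fun (k : ℕ) (p : Fin n → EuclideanSpace ℝ (Fin 3)) => (∏ i, rhoPin (u k * ‖p i‖)) *
        ((S n p / ∏ i, rhoPin (u k * ‖p i‖) +
          S n (fun i => inversion (0 : EuclideanSpace ℝ (Fin 3)) 1 (p i)) /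
            ∏ i, rhoPin (u k * ‖inversion (0 : EuclideanSpace ℝ (Fin 3)) 1 (p i)‖)) / 2))
      (S n) atTop (NonCoincident 3 n ∩ {p | ∀ i, p i ≠ 0}) := by
  set X : Set (Fin n → EuclideanSpace ℝ (Fin 3)) := NonCoincident 3 n ∩ {p | ∀ i, p i ≠ 0}
  have hSX : ContinuousOn (S n) X := hS.mono inter_subset_left
  rw [proxy_tendstoLocallyUniformlyOn_iff hSX]
  rw [proxy_tendstoLocallyUniformlyOn_iff hwc] at hratio
  intro x hx
  have t1 : Tendsto (fun y : ℕ × (Fin n → EuclideanSpace ℝ (Fin 3)) => S n y.2) (atTop ×ˢ 𝓝[X] x)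
      (𝓝 (S n x)) :=
    (hSX x hx).tendsto.comp tendsto_snd
  have tcoord : ∀ i, Tendsto (fun q : Fin n → EuclideanSpace ℝ (Fin 3) => q i) (𝓝[X] x)
      (𝓝[{0}ᶜ] (x i)) :=
    fun i => (continuous_apply i).continuousWithinAt.tendsto_nhdsWithin fun q hq => hq.2 i
  have tpair : ∀ i, Tendsto (fun y : ℕ × (Fin n → EuclideanSpace ℝ (Fin 3)) => (y.1, y.2 i))
      (atTop ×ˢ 𝓝[X] x) (atTop ×ˢ 𝓝[({0} : Set (EuclideanSpace ℝ (Fin 3)))ᶜ] (x i)) := fun i =>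
    tendsto_fst.prodMk ((tcoord i).comp tendsto_snd)
  -- (the composed maps are kept in `∘`-form: unfolding them by `rfl` against real division is expensive)
  have t2 := (tendsto_finsetProd Finset.univ
    fun i _ => ((hw'c (x i) (hx.2 i)).tendsto.comp (tcoord i))).comp
      (tendsto_snd (f := (atTop : Filter ℕ)) (g := 𝓝[X] x))
  have t3 := tendsto_finsetProd Finset.univ fun i _ => (hratio (x i) (hx.2 i)).comp (tpair i)
  have hlim : (S n x + (∏ i, w' (x i)) * S n x * ∏ i, w (x i)) / 2 = S n x := by
    rw [mul_comm (∏ i, w' (x i)) (S n x), mul_assoc, ← Finset.prod_mul_distrib,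
      Finset.prod_eq_one (fun i _ => hww' (x i) (hx.2 i)), mul_one, add_self_div_two]
  have T := (t1.add ((t2.mul t1).mul t3)).div_const 2
  rw [hlim] at T
  refine T.congr' ?_
  have hev : ∀ᶠ y : ℕ × (Fin n → EuclideanSpace ℝ (Fin 3)) in atTop ×ˢ 𝓝[X] x, y.2 ∈ X :=
    tendsto_snd.eventually eventually_mem_nhdsWithin
  filter_upwards [hev] with y hy
  have hR : (∏ i, rhoPin (u y.1 * ‖y.2 i‖)) ≠ 0 :=
    (Finset.prod_pos fun i _ => rhoPin_pos _).ne'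
  have hQ : (∏ i, rhoPin (u y.1 / ‖y.2 i‖)) ≠ 0 :=
    (Finset.prod_pos fun i _ => rhoPin_pos _).ne'
  simp only [Function.comp_apply]
  rw [hcov y.2 hy.2, Finset.prod_div_distrib]
  simp only [norm_inversion_zero_one, ← div_eq_mul_inv]
  field_simp

/-- **(⟸) for a covariant cluster point.** A non-degenerate cluster point of the pinned `ℤ³` zoom that is
scale covariant and inversion covariant with exponent `Δ` satisfies K1 "cluster proxy universality", with the
ι-symmetrised renormalised cluster point as proxies, the cluster sequence as meshes and the forced weight
`‖·‖^{-2Δ}`. [folklore] -/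
theorem proxy_of_covariant {S : CorrFamily 3} (hS : IsClusterPoint S) (hnd : IsNondegenerateTwoPoint S)
    {Δ : ℝ} (hsc : IsScaleCovariant Δ S) (hinv : IsInversionCovariant Δ S) :
    ∃ (P : ℕ → Literature.Probability.LatticeModels.CorrFamily 3) (u : ℕ → ℝ) (w : EuclideanSpace ℝ (Fin 3) → ℝ), (∀ (k n : ℕ) (p : Fin n → EuclideanSpace ℝ (Fin 3)), (∀ i, p i ≠ 0) → P k n (fun i => EuclideanGeometry.inversion (0 : EuclideanSpace ℝ (Fin 3)) 1 (p i)) = P k n p) ∧ Filter.Tendsto u Filter.atTop (nhdsWithin 0 (Set.Ioi 0)) ∧ (∀ n, TendstoLocallyUniformlyOn (fun k => Literature.Probability.LatticeModels.rescaledCorrelator (Literature.Probability.LatticeModels.criticalCorr 3) Summit.CriticalPhenomena.Ising3DConformalLimit.MoebiusLimitExistsOnlyInteraction.rhoPin n (u k)) (S n) Filter.atTop (Literature.Probability.LatticeModels.NonCoincident 3 n)) ∧ (∀ n, TendstoLocallyUniformlyOn (fun (k : ℕ) (p : Fin n → EuclideanSpace ℝ (Fin 3)) => (∏ i, Summit.CriticalPhenomena.Ising3DConformalLimit.MoebiusLimitExistsOnlyInteraction.rhoPin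 (u k * ‖p i‖)) * P k n p) (S n) Filter.atTop (Literature.Probability.LatticeModels.NonCoincident 3 n ∩ {p | ∀ i, p i ≠ 0})) ∧ (∀ v, v ≠ 0 → 0 < w v) ∧ ContinuousOn w {0}ᶜ ∧ TendstoLocallyUniformlyOn (fun (k : ℕ) (p : EuclideanSpace ℝ (Fin 3)) => Summit.CriticalPhenomena.Ising3DConformalLimit.MoebiusLimitExistsOnlyInteraction.rhoPin (u k * ‖p‖) / Summit.CriticalPhenomena.Ising3DConformalLimit.MoebiusLimitExistsOnlyInteraction.rhoPin (u k / ‖p‖)) w Filter.atTop {0}ᶜ := by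
  obtain ⟨u, hu, hconv⟩ := hS
  have h01 : S 2 ![0, EuclideanSpace.single 0 1] = 1 := clusterPoint_cfg01 ⟨u, hu, hconv⟩
  have hratio : TendstoLocallyUniformlyOn
      (fun (k : ℕ) (p : EuclideanSpace ℝ (Fin 3)) => rhoPin (u k * ‖p‖) / rhoPin (u k / ‖p‖))
      (fun v => (‖v‖ ^ (2 * Δ))⁻¹) atTop {0}ᶜ :=
    (proxy_ratio_tendstoLocallyUniformlyOn hu (hconv 2) hnd).congr_right fun v hv => proxy_W_eq hsc h01 hv
  have hwpos : ∀ v : EuclideanSpace ℝ (Fin 3), v ≠ 0 → 0 < (‖v‖ ^ (2 * Δ))⁻¹ := fun v hv =>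
    inv_pos.2 (Real.rpow_pos_of_pos (norm_pos_iff.2 hv) _)
  have hw'c : ContinuousOn (fun v : EuclideanSpace ℝ (Fin 3) => ‖v‖ ^ (2 * Δ)) {0}ᶜ :=
    continuous_norm.continuousOn.rpow_const fun v hv => Or.inl (norm_ne_zero_iff.2 hv)
  have hwc : ContinuousOn (fun v : EuclideanSpace ℝ (Fin 3) => (‖v‖ ^ (2 * Δ))⁻¹) {0}ᶜ :=
    hw'c.inv₀ fun v hv => (Real.rpow_pos_of_pos (norm_pos_iff.2 hv) _).ne'
  refine ⟨fun k n p => (S n p / ∏ i, rhoPin (u k * ‖p i‖) +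
      S n (fun i => inversion (0 : EuclideanSpace ℝ (Fin 3)) 1 (p i)) /
        ∏ i, rhoPin (u k * ‖inversion (0 : EuclideanSpace ℝ (Fin 3)) 1 (p i)‖)) / 2,
    u, fun v => (‖v‖ ^ (2 * Δ))⁻¹, ?_, hu, hconv, ?_, hwpos, hwc, hratio⟩
  · intro k n p _
    simp only [inversion_inversion _ (one_ne_zero (α := ℝ))]
    ring
  · intro n
    exact proxy_renormalised_tendsto (w := fun v => (‖v‖ ^ (2 * Δ))⁻¹) (w' := fun v => ‖v‖ ^ (2 * Δ))
      (continuousOn_seqLimit hu (hconv n)) (hinv n) hw'c hwc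
      (fun v hv => mul_inv_cancel₀ (Real.rpow_pos_of_pos (norm_pos_iff.2 hv) _).ne') hratio

/-! ### The registered sub-goal -/

/-- **Sub-goal `clusterProxyUniversality_iff_inversionCovariant` of line `Sketch`, crux
`ReflectionTwin.ExistsContinuousLimit` (stmt-CriticalPhenomena-4582), registered signature verbatim: for a
normalised, non-degenerate cluster point `S` of the pinned `ℤ³` zoom, the ideator's K1 "cluster proxy
universality" (`S` is the locally renormalised limit of EXACTLY inversion-symmetric lattice families along the
meshes, with convergent pinned weight ratios) is EQUIVALENT to K1′ (covariance of `S` under the unit inversion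
with some continuous positive weight).** (⟹) is the landed K3 `stub_subsequentialInversionTransfer`; (⟸): K2
`stub_inversionBegetsDilation` makes `S` scale and inversion covariant with one `Δ` (translation invariance and
continuity of cluster points are automatic), and then the ι-symmetrised renormalised cluster point is a proxy
family with the lattice-forced weight `‖·‖^{-2Δ}` (`proxy_of_covariant`). [folklore] -/
theorem clusterProxyUniversality_iff_inversionCovariant : ∀ S : Literature.Probability.LatticeModels.CorrFamily 3, (∀ n z, z ∉ Literature.Probability.LatticeModels.NonCoincident 3 n → S n z = 0) → Summit.CriticalPhenomena.Ising3DConformalLimit.MoebiusLimitExistsOnlyInteraction.IsClusterPoint S → Literature.Probability.LatticeModels.IsNondegenerateTwoPoint S → ((∃ (P : ℕ → Literature.Probability.LatticeModels.CorrFamily 3) (u : ℕ → ℝ) (w : EuclideanSpace ℝ (Fin 3) → ℝ), (∀ (k n : ℕ) (p : Fin n → EuclideanSpace ℝ (Fin 3)), (∀ i, p i ≠ 0) → P k n (fun i => EuclideanGeometry.inversion (0 : EuclideanSpace ℝ (Fin 3)) 1 (p i)) = P k n p) ∧ Filter.Tendsto u Filter.atTop (nhdsWithin 0 (Set.Ioi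 0)) ∧ (∀ n, TendstoLocallyUniformlyOn (fun k => Literature.Probability.LatticeModels.rescaledCorrelator (Literature.Probability.LatticeModels.criticalCorr 3) Summit.CriticalPhenomena.Ising3DConformalLimit.MoebiusLimitExistsOnlyInteraction.rhoPin n (u k)) (S n) Filter.atTop (Literature.Probability.LatticeModels.NonCoincident 3 n)) ∧ (∀ n, TendstoLocallyUniformlyOn (fun (k : ℕ) (p : Fin n → EuclideanSpace ℝ (Fin 3)) => (∏ i, Summit.CriticalPhenomena.Ising3DConformalLimit.MoebiusLimitExistsOnlyInteraction.rhoPin (u k * ‖p i‖)) * P k n p) (S n) Filter.atTop (Literature.Probability.LatticeModels.NonCoincident 3 n ∩ {p | ∀ i, p i ≠ 0})) ∧ (∀ v, v ≠ 0 → 0 < w v) ∧ ContinuousOn w {0}ᶜ ∧ TendstoLocallyUniformlyOn (fun (k : ℕ) (p : EuclideanSpace ℝ (Fin 3)) => Summit.CriticalPhenomena.Ising3DConformalLimit.MoebiusLimitExistsOnlyInteraction.rhoPin (u k * ‖p‖) / Summit.CriticalPhenomena.Ising3DConformalLimit.MoebiusLimitExistsOnlyInteraction.rhoPin (u k / ‖p‖))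 w Filter.atTop {0}ᶜ) ↔ (∃ w : EuclideanSpace ℝ (Fin 3) → ℝ, (∀ v, v ≠ 0 → 0 < w v) ∧ ContinuousOn w {0}ᶜ ∧ ∀ (n : ℕ) (x : Fin n → EuclideanSpace ℝ (Fin 3)), (∀ i, x i ≠ 0) → S n (fun i => EuclideanGeometry.inversion (0 : EuclideanSpace ℝ (Fin 3)) 1 (x i)) = (∏ i, w (x i)) * S n x)) := by
  intro S hN hS hnd
  constructor
  · rintro ⟨P, u, w, hP, hu, -, hPconv, hwpos, hwcont, hratio⟩
    exact stub_subsequentialInversionTransfer P u S w hP hu hN hPconv hwpos hwcont hratio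
  · rintro ⟨w', hw'pos, hw'cont, hcov⟩
    have hcont : ∀ n, ContinuousOn (S n) (NonCoincident 3 n) := by
      obtain ⟨u, hu, hconv⟩ := hS
      exact fun n => continuousOn_seqLimit hu (hconv n)
    obtain ⟨Δ, hsc, hinv⟩ := stub_inversionBegetsDilation S hN hcont (isTranslationInvariant_of_isClusterPoint hN hS) hnd
      w' hw'pos hw'cont hcov
    exact proxy_of_covariant hS hnd hsc hinv

end Summit.CriticalPhenomena.Ising3DConformalLimit.ReflectionTwinExistsContinuousLimit

end
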